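import Literature.Analysis.FunctionSpaces.UniformRandomWalkDensity
import Literature.NumberTheory.ModularForms.DombEtaQuotientCMSigns
import HarnessLib

/-!
# Borwein–Straub–Wan–Zudilin Theorem 9 reduced to the modular parametrisation of `p₄` at one point

Sibling of `Literature/Analysis/FunctionSpaces/UniformRandomWalkDensity.lean` (the named fact
`BorweinStraubWanZudilin2012_thm9 : p₄(1) = √(G/5)/(2π²)`,
`G = Γ(1/15)Γ(2/15)Γ(4/15)Γ(8/15)/(Γ(7/15)Γ(11/15)Γ(13/15)Γ(14/15))`, with `p₄(1)` = the tree's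
`pearsonDensityFourAtOne = ∫₀^∞ tJ₀(t)⁵dt`) and of the level-6 CM evaluations
`NumberTheory/ModularForms/DombEtaQuotientCMValues.lean`, `…CMSigns.lean`.

[BorweinEtAl2012] prove Theorem 9 in two halves: (i) the modular parametrisation of the density,
`p₄(x(τ)) = (6(2τ+1)/π) η(τ)η(2τ)η(3τ)η(6τ)`, `x(τ) = 8i(η(2τ)η(6τ)/(η(τ)η(3τ)))³` (§4 Remark 7,
eq. (p4modular)) at the point `τ₀ = (√(−5/3) − 1)/2 = −1/2 + i√15/6` where "the argument attains the
value 1", and (ii) the Chowla–Selberg evaluation of the `η`-values there (§5, "the 5/3rd singular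
value"). Half (ii) is DONE in the tree: `x(τ₀)² = −64 t(τ₀) = 1` (`dombHauptmodul_bswzPoint`) and
`|6(2τ₀+1)/π| · |η(τ₀)η(2τ₀)η(3τ₀)η(6τ₀)| = √(G/5)/(2π²)` (`bswz_modular_value`). This file records
the resulting REDUCTION (pure rewriting, everything proved):

* `BorweinStraubWanZudilin2012_thm9_iff_norm_eta_prod` — **Theorem 9 ⟺
  `p₄(1) = |6(2τ₀+1)/π| · |η(τ₀)η(2τ₀)η(3τ₀)η(6τ₀)|`**, i.e. Theorem 9 is EXACTLY (p4modular) at `τ₀`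
  in absolute value;
* `BorweinStraubWanZudilin2012_thm9_iff_dombModularForm` — **Theorem 9 ⟺
  `p₄(1) = (√15/(4π)) · Z(τ₀)`**, `Z = η(τ)⁴η(3τ)⁴/(η(2τ)²η(6τ)²) ∈ M₂(Γ₀(6))` the Chan–Zudilin form
  (`Z(τ₀) = 2√(G/75)/π`, `dombModularForm_bswzPoint`) — the form in which (p4modular) is used:
  `p₄(x) = −(3x/(4π²)) y₁(x²/64)` with `y₁(−t(τ)) = (2τ+1)πi Z(τ)` and `(2τ₀+1)πi = −π√15/3`.

What remains for Theorem 9 is thus the analytic identity `p₄(1) = −(3/(4π²)) y₁(1/64)` (BSWZ Thm. 6)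
together with `y₁(1/64) = −(π√15/3) Z(τ₀)` (Chan–Zudilin's parametrisation, BSWZ (y0modular),
(y1y0)); neither is asserted here.

## References

* [BorweinEtAl2012] J. M. Borwein, A. Straub, J. Wan, W. Zudilin, *Densities of short uniform random
  walks*, Canad. J. Math. 64 (2012) 961–990 (arXiv:1103.2995), §4 Remark 7 (eqs. (p4y1),
  (y0modular), (y1y0), (p4modular)), §5 Thm. 9.
-/

noncomputable section

open UpperHalfPlane hiding I
open Complex
open scoped Real ModularForm

open Literature.NumberTheory.ModularForms
open Literature.NumberTheory.EllipticCurves.ModularForms (etaQuotient)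

namespace Literature.Analysis.FunctionSpaces

/-- **Theorem 9 ⟺ (p4modular) at `τ₀` in absolute value**:
`p₄(1) = √(G/5)/(2π²) ⟺ p₄(1) = |6(2τ₀+1)/π| · |η(τ₀)| |η(2τ₀)| |η(3τ₀)| |η(6τ₀)|`,
`τ₀ = −1/2 + i√15/6`. [cite: BorweinEtAl2012, §4 Remark 7 (p4modular) and §5 Thm. 9] -/
theorem BorweinStraubWanZudilin2012_thm9_iff_norm_eta_prod :
    BorweinStraubWanZudilin2012_thm9 ↔
      pearsonDensityFourAtOne =
        ‖(6 * (2 * ((bswzPoint : ℍ) : ℂ) + 1) / π)‖ *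
          (‖η ((bswzPoint : ℍ) : ℂ)‖ * ‖η (2 * ((bswzPoint : ℍ) : ℂ))‖ *
            ‖η (3 * ((bswzPoint : ℍ) : ℂ))‖ * ‖η (6 * ((bswzPoint : ℍ) : ℂ))‖) := by
  rw [BorweinStraubWanZudilin2012_thm9, bswz_modular_value]

/-- `|6(2τ₀+1)/π| = 2√15/π`. [folklore] -/
theorem norm_bswz_prefactor :
    ‖(6 * (2 * ((bswzPoint : ℍ) : ℂ) + 1) / π)‖ = 2 * Real.sqrt 15 / π := by
  have hval : (6 * (2 * ((bswzPoint : ℍ) : ℂ) + 1) / π : ℂ) = ((2 * Real.sqrt 15 / π : ℝ) : ℂ) * I := by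
    have hπ0 : (π : ℂ) ≠ 0 := Complex.ofReal_ne_zero.mpr Real.pi_ne_zero
    rw [coe_bswzPoint]
    push_cast
    field_simp
    ring
  rw [hval, norm_mul, Complex.norm_I, mul_one, Complex.norm_real,
    Real.norm_of_nonneg (by positivity)]

/-- **Theorem 9 ⟺ `p₄(1) = (√15/(4π)) Z(τ₀)`** with `Z = η(τ)⁴η(3τ)⁴/(η(2τ)²η(6τ)²)` the weight-2
form of the Chan–Zudilin parametrisation (`Z(τ₀) = 2√(G/75)/π > 0`): the form in which the source
uses (p4modular), `p₄(1) = −(3/(4π²)) y₁(1/64)` and `y₁(1/64) = (2τ₀+1)πi Z(τ₀) = −(π√15/3) Z(τ₀)`.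
[cite: BorweinEtAl2012, §4 Remark 7 (p4y1), (y0modular), (y1y0)] -/
theorem BorweinStraubWanZudilin2012_thm9_iff_dombModularForm :
    BorweinStraubWanZudilin2012_thm9 ↔
      (pearsonDensityFourAtOne : ℂ) =
        (Real.sqrt 15 / (4 * π) : ℝ) * etaQuotient 6 dombExponents bswzPoint := by
  rw [BorweinStraubWanZudilin2012_thm9, dombModularForm_bswzPoint]
  set G := Real.Gamma (1 / 15) * Real.Gamma (2 / 15) * Real.Gamma (4 / 15) *
        Real.Gamma (8 / 15) / (Real.Gamma (7 / 15) * Real.Gamma (11 / 15) * Real.Gamma (13 / 15) *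
          Real.Gamma (14 / 15)) with hG
  have hGpos : 0 < G := by
    have hΓ : ∀ x : ℝ, 0 < x → 0 < Real.Gamma x := fun x hx => Real.Gamma_pos_of_pos hx
    have := hΓ (1/15) (by norm_num); have := hΓ (2/15) (by norm_num); have := hΓ (4/15) (by norm_num)
    have := hΓ (8/15) (by norm_num); have := hΓ (7/15) (by norm_num); have := hΓ (11/15) (by norm_num)
    have := hΓ (13/15) (by norm_num); have := hΓ (14/15) (by norm_num)
    positivity
  have hG5 : Real.Gamma (1 / 15) * Real.Gamma (2 / 15) * Real.Gamma (4 / 15) *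
        Real.Gamma (8 / 15) / (5 * (Real.Gamma (7 / 15) * Real.Gamma (11 / 15) * Real.Gamma (13 / 15) *
          Real.Gamma (14 / 15))) = G / 5 := by
    rw [hG]; field_simp
  rw [hG5]
  -- the two real right-hand sides agree
  have hπ : 0 < π := Real.pi_pos
  have key : 1 / (2 * π ^ 2) * Real.sqrt (G / 5) =
      Real.sqrt 15 / (4 * π) * (2 * Real.sqrt (G / 75) / π) := by
    have h1 : Real.sqrt (G / 5) = Real.sqrt 15 * Real.sqrt (G / 75) := by
      rw [← Real.sqrt_mul (by norm_num)]
      congr 1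
      ring
    rw [h1]
    field_simp
    ring
  rw [key, ← Complex.ofReal_mul]
  exact ⟨fun h => by rw [h], fun h => by exact_mod_cast h⟩

end Literature.Analysis.FunctionSpaces

end
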